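import Mathlib
import HarnessLib
import Literature.Combinatorics.Additive.Pollard

/-!
# Grynkiewicz's extension of Pollard's theorem — port, part I: the representation function and `N_t`

Topic: `Literature/Combinatorics/Additive`.  First file of the port of [Gry10] Theorem 1.1 / 1.2
(`Literature.Combinatorics.Additive.grynkiewicz2010_thm_1_1` / `_1_2`, stated in
`GrynkiewiczPollardExtension.lean`): elementary bookkeeping for the representation function
`r_{A,B}(w) = #{(a,b) ∈ A × B : a + b = w}` (`Pollard.rep`) and for
`N_t(A,B) = Σ_{x ∈ A+B} min(t, r_{A,B}(x)) = Σ_{i ≤ t} |A +_i B|` (`Grynkiewicz.NS`): positivity, erasing one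
element (the "drop" `N_t(A,B) − N_t(A, B ∖ {y})`), monotonicity, the small-set evaluations `N_t = |A||B|`
(`|B| ≤ t`) and `N_t ≥ t|A|` (`|B| ≥ t`), the `|B| = t + 1` evaluation, the split
`N_t = t·#{r ≥ t} + Σ_{r < t} r`, the few-deletions bound, the Dyson-transform comparison and translation
invariance.  Arbitrary (not necessarily finite) abelian ambient group, as in the printed theorem.

## References
* D. J. Grynkiewicz, *On extending Pollard's theorem for t-representable sums*, Israel J. Math. 177 (2010)
  413–439 (arXiv:0803.2601), §2 [cite: Grynkiewicz2010, Thm 1.1].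
* M. B. Nathanson, *Additive Number Theory: Inverse Problems and the Geometry of Sumsets*, GTM 165 (1996),
  proof of Thm 2.4 [cite: Nathanson1996, Thm 2.4].
-/

namespace Literature.Combinatorics.Additive

namespace Grynkiewicz

open Finset Pollard
open scoped Pointwise

variable {G : Type*} [AddCommGroup G] [DecidableEq G]

/-! ### The representation function: membership, one-sided counts, insert/erase -/

/-- `r_{A,B}(x)` counted through the first coordinate: `#{a ∈ A : x - a ∈ B}`. [cite: Nathanson1996, Thm 2.4 (proof)] -/
theorem rep_eq_card_filter_left (A B : Finset G) (x : G) :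
    rep A B x = (A.filter (fun a => x - a ∈ B)).card := by
  rw [rep_comm, rep_eq_card_filter_right]

/-- `r_{A,B}(w) > 0 ↔ w ∈ A + B`. [cite: Grynkiewicz2010, §1] -/
theorem rep_pos_iff {A B : Finset G} {w : G} : 0 < rep A B w ↔ w ∈ A + B := by
  rw [rep_def, card_pos]
  constructor
  · rintro ⟨⟨a, b⟩, h⟩
    rw [mem_filter, mem_product] at h
    exact mem_add.2 ⟨a, h.1.1, b, h.1.2, h.2⟩
  · intro h
    obtain ⟨a, ha, b, hb, hab⟩ := mem_add.1 h
    exact ⟨(a, b), mem_filter.2 ⟨mem_product.2 ⟨ha, hb⟩, hab⟩⟩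

/-- `w ∉ A + B → r_{A,B}(w) = 0`. [cite: Grynkiewicz2010, §1] -/
theorem rep_eq_zero_of_not_mem {A B : Finset G} {w : G} (h : w ∉ A + B) : rep A B w = 0 := by
  by_contra h0
  exact h (rep_pos_iff.1 (Nat.pos_of_ne_zero h0))

/-- `w ∈ A + B → 1 ≤ r_{A,B}(w)`. [cite: Grynkiewicz2010, §1] -/
theorem one_le_rep_of_mem {A B : Finset G} {w : G} (h : w ∈ A + B) : 1 ≤ rep A B w :=
  rep_pos_iff.2 h

/-- If `r_{A,B}(w) ≥ k ≥ 1` then `w ∈ A + B`. [cite: Grynkiewicz2010, §1] -/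
theorem mem_add_of_le_rep {A B : Finset G} {w : G} {k : ℕ} (hk : 1 ≤ k) (h : k ≤ rep A B w) : w ∈ A + B :=
  rep_pos_iff.1 (lt_of_lt_of_le hk h)

/-- `a + b` has at least one representation. [cite: Grynkiewicz2010, §1] -/
theorem one_le_rep_add {A B : Finset G} {a b : G} (ha : a ∈ A) (hb : b ∈ B) : 1 ≤ rep A B (a + b) :=
  one_le_rep_of_mem (add_mem_add ha hb)

/-- Monotonicity in the first set. [cite: Nathanson1996, Thm 2.4 (proof)] -/
theorem rep_mono_left {A A' : Finset G} (h : A' ⊆ A) (B : Finset G) (x : G) :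
    rep A' B x ≤ rep A B x := by
  rw [rep_comm A', rep_comm A]; exact rep_mono_right B h x

/-- Monotonicity in both sets. [cite: Nathanson1996, Thm 2.4 (proof)] -/
theorem rep_mono {A A' B B' : Finset G} (hA : A' ⊆ A) (hB : B' ⊆ B) (x : G) :
    rep A' B' x ≤ rep A B x :=
  (rep_mono_left hA B' x).trans (rep_mono_right A hB x)

/-- `r_{A,{y}}(w) = [w - y ∈ A]`. [cite: Nathanson1996, Thm 2.4 (proof)] -/
theorem rep_singleton_right (A : Finset G) (y w : G) :
    rep A {y} w = if w - y ∈ A then 1 else 0 := by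
  rw [rep_eq_card_filter_right, filter_singleton]
  split_ifs <;> simp

/-- Erasing one element of `B`: `r_{A,B}(w) = r_{A,B∖{y}}(w) + [w - y ∈ A]`. [cite: Grynkiewicz2010, §2 Step 2] -/
theorem rep_erase_right {A B : Finset G} {y : G} (hy : y ∈ B) (w : G) :
    rep A B w = rep A (B.erase y) w + if w - y ∈ A then 1 else 0 := by
  conv_lhs => rw [← insert_erase hy, insert_eq, union_comm]
  rw [rep_union_right A (disjoint_singleton_right.2 (notMem_erase y B)), rep_singleton_right]

/-- Erasing one element of `A`: `r_{A,B}(w) = r_{A∖{y},B}(w) + [w - y ∈ B]`. [cite: Grynkiewicz2010, §2 Step 2] -/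
theorem rep_erase_left {A B : Finset G} {y : G} (hy : y ∈ A) (w : G) :
    rep A B w = rep (A.erase y) B w + if w - y ∈ B then 1 else 0 := by
  rw [rep_comm, rep_erase_right hy, rep_comm]

/-- Inserting a new element into `B`: `r_{A,B ∪ {y}}(w) = r_{A,B}(w) + [w - y ∈ A]`. [cite: Grynkiewicz2010, §2 Case 4.2] -/
theorem rep_insert_right {A B : Finset G} {y : G} (hy : y ∉ B) (w : G) :
    rep A (insert y B) w = rep A B w + if w - y ∈ A then 1 else 0 := by
  rw [rep_erase_right (mem_insert_self y B), erase_insert hy]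

/-- Inserting a new element into `A`. [cite: Grynkiewicz2010, §2 Case 4.2] -/
theorem rep_insert_left {A B : Finset G} {y : G} (hy : y ∉ A) (w : G) :
    rep (insert y A) B w = rep A B w + if w - y ∈ B then 1 else 0 := by
  rw [rep_comm, rep_insert_right hy, rep_comm]

/-- Few deletions: if `w ∉ A' + B'`, then every representation of `w` in `A + B` uses an element of `A ∖ A'`
or of `B ∖ B'`, so `r_{A,B}(w) ≤ |A ∖ A'| + |B ∖ B'|`. [cite: Grynkiewicz2010, §2 Step 2] -/
theorem rep_le_card_sdiff_add {A A' B B' : Finset G} {w : G} (hw : w ∉ A' + B') :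
    rep A B w ≤ (A \ A').card + (B \ B').card := by
  rw [rep_eq_card_filter_left]
  have hsplit : A.filter (fun a => w - a ∈ B) ⊆
      (A \ A') ∪ ((A.filter (fun a => w - a ∈ B)).filter (fun a => a ∈ A')) := by
    intro a ha
    rw [mem_union, mem_sdiff, mem_filter]
    by_cases h : a ∈ A'
    · exact Or.inr ⟨ha, h⟩
    · exact Or.inl ⟨(mem_filter.1 ha).1, h⟩
  refine (card_le_card hsplit).trans ((card_union_le _ _).trans (Nat.add_le_add_left ?_ _))
  have hinj : Set.InjOn (fun a => w - a) ↑((A.filter (fun a => w - a ∈ B)).filter (fun a => a ∈ A')) :=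
    fun a _ a' _ (h : w - a = w - a') => sub_right_injective h
  rw [← card_image_of_injOn hinj]
  refine card_le_card fun b hb => ?_
  obtain ⟨a, ha, rfl⟩ := mem_image.1 hb
  rw [mem_filter, mem_filter] at ha
  refine mem_sdiff.2 ⟨ha.1.2, fun hb' => hw ?_⟩
  have : w = a + (w - a) := by abel
  rw [this]
  exact add_mem_add ha.2 hb'

/-- `Σ_{x ∈ S} r_{A,B}(x) = |A||B|` for any `S ⊇ A + B`. [cite: Nathanson1996, Thm 2.4 (proof)] -/
theorem sum_rep_of_subset {A B S : Finset G} (h : A + B ⊆ S) : ∑ x ∈ S, rep A B x = A.card * B.card := by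
  unfold rep
  rw [← card_product]
  exact (card_eq_sum_card_fiberwise (s := A ×ˢ B) (t := S) (f := fun ab => ab.1 + ab.2)
    (fun ab hab => h (add_mem_add (mem_product.1 hab).1 (mem_product.1 hab).2))).symm

/-! ### `N_t(A,B) = Σ_{x ∈ A+B} min(t, r_{A,B}(x))` -/

/-- `N_t(A,B) := Σ_{x ∈ A + B} min(t, r_{A,B}(x)) = Σ_{i=1}^t |A +_i B|` (the left side of [Gry10] (6)).
[cite: Grynkiewicz2010, Thm 1.1] -/
def NS (t : ℕ) (A B : Finset G) : ℕ := ∑ x ∈ A + B, min t (rep A B x)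

/-- Unfolding. [cite: Grynkiewicz2010, Thm 1.1] -/
theorem NS_def (t : ℕ) (A B : Finset G) : NS t A B = ∑ x ∈ A + B, min t (rep A B x) := rfl

/-- `N_t` as a sum over any `S ⊇ A + B` (terms outside `A + B` vanish). [cite: Grynkiewicz2010, Thm 1.1] -/
theorem NS_eq_sum_of_subset (t : ℕ) {A B S : Finset G} (h : A + B ⊆ S) :
    NS t A B = ∑ x ∈ S, min t (rep A B x) := by
  unfold NS
  exact sum_subset h fun x _ hx => by rw [rep_eq_zero_of_not_mem hx, Nat.min_zero]

/-- Symmetry `N_t(A,B) = N_t(B,A)`. [cite: Grynkiewicz2010, §2] -/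
theorem NS_comm (t : ℕ) (A B : Finset G) : NS t A B = NS t B A := by
  unfold NS; rw [add_comm A B]; exact sum_congr rfl fun w _ => by rw [rep_comm]

/-- Monotonicity of `N_t` in the second set. [cite: Nathanson1996, Thm 2.4 (proof)] -/
theorem NS_mono_right (t : ℕ) (A : Finset G) {B B' : Finset G} (h : B' ⊆ B) : NS t A B' ≤ NS t A B := by
  rw [NS_eq_sum_of_subset t (add_subset_add_left h : A + B' ⊆ A + B), NS_def]
  exact sum_le_sum fun w _ => min_le_min_left _ (rep_mono_right A h w)

/-- Monotonicity of `N_t` in the first set. [cite: Nathanson1996, Thm 2.4 (proof)] -/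
theorem NS_mono_left (t : ℕ) {A A' : Finset G} (h : A' ⊆ A) (B : Finset G) : NS t A' B ≤ NS t A B := by
  rw [NS_comm, NS_comm t A]; exact NS_mono_right t B h

/-- `N_t ≤ Σ r = |A||B|`. [cite: Nathanson1996, Thm 2.4 (proof)] -/
theorem NS_le_card_mul_card (t : ℕ) (A B : Finset G) : NS t A B ≤ A.card * B.card := by
  rw [← sum_rep_of_subset (Subset.refl (A + B))]; exact sum_le_sum fun w _ => min_le_right _ _

/-- `N_t ≤ t · |A + B|`. [cite: Grynkiewicz2010, §2] -/
theorem NS_le_mul_card_add (t : ℕ) (A B : Finset G) : NS t A B ≤ t * (A + B).card := by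
  unfold NS
  calc ∑ x ∈ A + B, min t (rep A B x) ≤ ∑ _x ∈ A + B, t := sum_le_sum fun w _ => min_le_left _ _
    _ = t * (A + B).card := by rw [sum_const, smul_eq_mul, mul_comm]

/-- `|A + B| ≤ N_t` for `t ≥ 1` (every sum contributes at least `1`). [cite: Grynkiewicz2010, §2] -/
theorem card_add_le_NS {t : ℕ} (ht : 1 ≤ t) (A B : Finset G) : (A + B).card ≤ NS t A B := by
  unfold NS
  calc (A + B).card = ∑ _x ∈ A + B, 1 := by rw [sum_const, smul_eq_mul, mul_one]
    _ ≤ ∑ x ∈ A + B, min t (rep A B x) := sum_le_sum fun w hw => le_min ht (one_le_rep_of_mem hw)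

/-- If `|B| ≤ t` then `N_t(A,B) = |A||B|` (every `r ≤ |B| ≤ t`). [cite: Grynkiewicz2010, §2 (base case)] -/
theorem NS_eq_card_mul_card {t : ℕ} (A : Finset G) {B : Finset G} (hB : B.card ≤ t) :
    NS t A B = A.card * B.card := by
  rw [← sum_rep_of_subset (Subset.refl (A + B))]
  exact sum_congr rfl fun w _ => min_eq_right ((rep_le_card_right A B w).trans hB)

/-- If `|A| ≤ t` then `N_t(A,B) = |A||B|`. [cite: Grynkiewicz2010, §2 (base case)] -/
theorem NS_eq_card_mul_card_left {t : ℕ} {A : Finset G} (hA : A.card ≤ t) (B : Finset G) :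
    NS t A B = A.card * B.card := by
  rw [NS_comm, NS_eq_card_mul_card B hA, mul_comm]

/-- If `|B| ≥ t` then `N_t(A,B) ≥ t|A|` (restrict to a `t`-subset of `B`). [cite: Grynkiewicz2010, §2 Case 3.2] -/
theorem mul_card_le_NS {t : ℕ} (A : Finset G) {B : Finset G} (hB : t ≤ B.card) : t * A.card ≤ NS t A B := by
  obtain ⟨B0, hB0, hcard⟩ := exists_subset_card_eq hB
  calc t * A.card = A.card * B0.card := by rw [hcard, mul_comm]
    _ = NS t A B0 := (NS_eq_card_mul_card A hcard.le).symm
    _ ≤ NS t A B := NS_mono_right t A hB0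

/-- If `|A| ≥ t` then `N_t(A,B) ≥ t|B|`. [cite: Grynkiewicz2010, §2 Case 3.2] -/
theorem mul_card_le_NS_left {t : ℕ} {A : Finset G} (hA : t ≤ A.card) (B : Finset G) :
    t * B.card ≤ NS t A B := by
  rw [NS_comm]; exact mul_card_le_NS B hA

/-- The drop when one element of `B` is erased:
`N_t(A,B) = N_t(A, B ∖ {y}) + #{a ∈ A : r_{A,B∖{y}}(a + y) < t}`. [cite: Grynkiewicz2010, §2 Step 2] -/
theorem NS_erase_right (t : ℕ) (A : Finset G) {B : Finset G} {y : G} (hy : y ∈ B) :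
    NS t A B = NS t A (B.erase y) + (A.filter (fun a => rep A (B.erase y) (a + y) < t)).card := by
  rw [NS_eq_sum_of_subset t (add_subset_add_left (erase_subset y B) : A + B.erase y ⊆ A + B), NS_def]
  have key : ∀ w, min t (rep A B w) =
      min t (rep A (B.erase y) w) + if (w - y ∈ A ∧ rep A (B.erase y) w < t) then 1 else 0 := by
    intro w
    rw [rep_erase_right hy]
    by_cases h1 : w - y ∈ A
    · by_cases h2 : rep A (B.erase y) w < t
      · rw [if_pos h1, if_pos ⟨h1, h2⟩, min_eq_right h2.le, min_eq_right (by omega)]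
      · rw [if_pos h1, if_neg (fun h => h2 h.2), min_eq_left (by omega), min_eq_left (by omega), add_zero]
    · rw [if_neg h1, if_neg (fun h => h1 h.1), add_zero, add_zero]
  rw [sum_congr rfl fun w _ => key w, sum_add_distrib, sum_boole, Nat.cast_id]
  congr 1
  refine card_nbij' (fun w => w - y) (fun a => a + y) ?_ ?_ ?_ ?_
  · intro w hw
    rw [mem_coe, mem_filter] at hw ⊢
    exact ⟨hw.2.1, by rw [sub_add_cancel]; exact hw.2.2⟩
  · intro a ha
    rw [mem_coe, mem_filter] at ha ⊢
    exact ⟨add_mem_add ha.1 hy, by rw [add_sub_cancel_right]; exact ha.1, ha.2⟩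
  · intro w _; simp
  · intro a _; simp

/-- The drop in the form used by Grynkiewicz: `N_t(A,B) − N_t(A,B∖{y}) = #{a ∈ A : r_{A,B}(a+y) ≤ t}`.
[cite: Grynkiewicz2010, §2 Step 2] -/
theorem NS_erase_right' (t : ℕ) (A : Finset G) {B : Finset G} {y : G} (hy : y ∈ B) :
    NS t A B = NS t A (B.erase y) + (A.filter (fun a => rep A B (a + y) ≤ t)).card := by
  rw [NS_erase_right t A hy]
  congr 2
  ext a
  simp only [mem_filter, and_congr_right_iff]
  intro ha
  rw [rep_erase_right hy (a + y), add_sub_cancel_right, if_pos ha]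
  omega

/-- The drop when one element of `A` is erased. [cite: Grynkiewicz2010, §2 Step 2] -/
theorem NS_erase_left' (t : ℕ) {A : Finset G} (B : Finset G) {y : G} (hy : y ∈ A) :
    NS t A B = NS t (A.erase y) B + (B.filter (fun b => rep A B (y + b) ≤ t)).card := by
  rw [NS_comm, NS_erase_right' t B hy, NS_comm]
  congr 2
  ext b
  simp only [mem_filter, rep_comm B A, add_comm y b]

/-- Inserting an element all of whose new sums are already `t`-popular does not change `N_t`.
[cite: Grynkiewicz2010, §2 Case 4.2] -/
theorem NS_insert_right_of_popular (t : ℕ) (A : Finset G) {B : Finset G} {y : G} (hy : y ∉ B)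
    (hpop : ∀ a ∈ A, t ≤ rep A B (a + y)) : NS t A (insert y B) = NS t A B := by
  rw [NS_eq_sum_of_subset t (add_subset_add_left (subset_insert y B) : A + B ⊆ A + insert y B), NS_def]
  refine sum_congr rfl fun w _ => ?_
  rw [rep_insert_right hy]
  split_ifs with h
  · have := hpop _ h
    rw [sub_add_cancel] at this
    rw [min_eq_left this, min_eq_left (by omega)]
  · rw [add_zero]

/-- Symmetric version of `NS_insert_right_of_popular`. [cite: Grynkiewicz2010, §2 Case 4.2] -/
theorem NS_insert_left_of_popular (t : ℕ) {A : Finset G} (B : Finset G) {y : G} (hy : y ∉ A)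
    (hpop : ∀ b ∈ B, t ≤ rep A B (y + b)) : NS t (insert y A) B = NS t A B := by
  rw [NS_comm, NS_insert_right_of_popular t B hy (fun b hb => by rw [rep_comm, add_comm]; exact hpop b hb),
    NS_comm]

/-- After a popular insertion the `t`-popular sums are unchanged. [cite: Grynkiewicz2010, §2 Case 4.2] -/
theorem le_rep_insert_right_iff (t : ℕ) (A : Finset G) {B : Finset G} {y : G} (hy : y ∉ B)
    (hpop : ∀ a ∈ A, t ≤ rep A B (a + y)) (w : G) : t ≤ rep A (insert y B) w ↔ t ≤ rep A B w := by
  rw [rep_insert_right hy]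
  split_ifs with h
  · have := hpop _ h
    rw [sub_add_cancel] at this
    constructor <;> intro <;> omega
  · rw [add_zero]

/-- Symmetric version of `le_rep_insert_right_iff`. [cite: Grynkiewicz2010, §2 Case 4.2] -/
theorem le_rep_insert_left_iff (t : ℕ) {A : Finset G} (B : Finset G) {y : G} (hy : y ∉ A)
    (hpop : ∀ b ∈ B, t ≤ rep A B (y + b)) (w : G) : t ≤ rep (insert y A) B w ↔ t ≤ rep A B w := by
  rw [rep_comm, le_rep_insert_right_iff t B hy (fun b hb => by rw [rep_comm, add_comm]; exact hpop b hb),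
    rep_comm]

/-- The split `N_t = t · #{w ∈ A+B : r ≥ t} + Σ_{w ∈ A+B : r < t} r(w)`. [cite: Grynkiewicz2010, §2 Step 1] -/
theorem NS_eq_split (t : ℕ) (A B : Finset G) :
    NS t A B = t * ((A + B).filter (fun w => t ≤ rep A B w)).card +
      ∑ w ∈ (A + B).filter (fun w => rep A B w < t), rep A B w := by
  unfold NS
  rw [← sum_filter_add_sum_filter_not (A + B) (fun w => t ≤ rep A B w)]
  congr 1
  · rw [sum_const_nat (m := t) (fun w hw => min_eq_left (mem_filter.1 hw).2), mul_comm]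
  · have : (A + B).filter (fun w => ¬ t ≤ rep A B w) = (A + B).filter (fun w => rep A B w < t) :=
      filter_congr fun w _ => not_le
    rw [this]
    exact sum_congr rfl fun w hw => min_eq_right (mem_filter.1 hw).2.le

/-- `t · #{w : r ≥ t} ≤ N_t`. [cite: Grynkiewicz2010, §2 Step 1] -/
theorem mul_card_popular_le_NS (t : ℕ) (A B : Finset G) :
    t * ((A + B).filter (fun w => t ≤ rep A B w)).card ≤ NS t A B := by
  rw [NS_eq_split]; exact Nat.le_add_right _ _

/-- If every element of `A + B` is `t`-popular then `N_t = t |A + B|`. [cite: Grynkiewicz2010, §2 Case 4.2] -/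
theorem NS_eq_mul_card_add_of_popular {t : ℕ} {A B : Finset G} (h : ∀ w ∈ A + B, t ≤ rep A B w) :
    NS t A B = t * (A + B).card := by
  unfold NS
  rw [sum_const_nat (m := t) (fun w hw => min_eq_left (h w hw)), mul_comm]

/-- `N_t` on a set of size `t + 1`: `N_t(A,B) + #{w ∈ A + B : w - B ⊆ A} = (t+1)|A|` when `|B| = t + 1`
(an element has `t + 1` representations iff all of `w - B` lies in `A`). [cite: Grynkiewicz2010, §2 Case 3.2] -/
theorem NS_add_card_full_eq {t : ℕ} (A : Finset G) {B : Finset G} (hB : B.card = t + 1) :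
    NS t A B + ((A + B).filter (fun w => ∀ b ∈ B, w - b ∈ A)).card = (t + 1) * A.card := by
  have hr : ∀ w, rep A B w ≤ t + 1 := fun w => (rep_le_card_right A B w).trans hB.le
  have hfull : ∀ w, (∀ b ∈ B, w - b ∈ A) ↔ rep A B w = t + 1 := by
    intro w
    rw [rep_eq_card_filter_right, ← hB]
    constructor
    · intro h; rw [filter_true_of_mem h]
    · intro h
      have hEq : B.filter (fun b => w - b ∈ A) = B := eq_of_subset_of_card_le (filter_subset _ B) h.ge
      exact fun b hb => (filter_eq_self.1 hEq) b hb
  have key : ∀ w, min t (rep A B w) + (if (∀ b ∈ B, w - b ∈ A) then 1 else 0) = rep A B w := by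
    intro w
    by_cases h : ∀ b ∈ B, w - b ∈ A
    · rw [if_pos h, (hfull w).1 h, min_eq_left (Nat.le_succ t)]
    · rw [if_neg h, add_zero]
      exact min_eq_right (by have := hr w; have h2 := (hfull w).not.1 h; omega)
  unfold NS
  rw [← Nat.cast_id ((A + B).filter _).card, ← sum_boole, ← sum_add_distrib, sum_congr rfl fun w _ => key w,
    sum_rep_of_subset (Subset.refl _), hB, mul_comm]

/-! ### Dyson transform and translation -/

/-- Dyson/Nathanson: `r_{A ∪ B, A ∩ B} ≤ r_{A,B}` pointwise. [cite: Nathanson1996, Thm 2.4 (proof)] -/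
theorem rep_union_inter_le (A B : Finset G) (w : G) : rep (A ∪ B) (A ∩ B) w ≤ rep A B w := by
  rw [rep_eq_rep_union_inter_add A B w]; exact Nat.le_add_right _ _

/-- `(A ∪ B) + (A ∩ B) ⊆ A + B`. [cite: Grynkiewicz2010, §2 (dyson-sums)] -/
theorem union_add_inter_subset (A B : Finset G) : (A ∪ B) + (A ∩ B) ⊆ A + B := by
  intro w hw
  obtain ⟨u, hu, i, hi, rfl⟩ := mem_add.1 hw
  rw [mem_inter] at hi
  rcases mem_union.1 hu with h | h
  · exact add_mem_add h hi.2
  · exact mem_add.2 ⟨i, hi.1, u, h, add_comm i u⟩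

/-- `N_t(A ∪ B, A ∩ B) ≤ N_t(A,B)`. [cite: Grynkiewicz2010, §2 (dyson-sums)] -/
theorem NS_union_inter_le (t : ℕ) (A B : Finset G) : NS t (A ∪ B) (A ∩ B) ≤ NS t A B := by
  rw [NS_eq_sum_of_subset t (union_add_inter_subset A B), NS_def]
  exact sum_le_sum fun w _ => min_le_min_left _ (rep_union_inter_le A B w)

/-- A translate as an image: `x +ᵥ B = B.image (· + x)` (translation bookkeeping of Nathanson's proof). [cite: Nathanson1996, Thm 2.4 (proof)] -/
theorem vadd_finset_eq_image (x : G) (B : Finset G) : x +ᵥ B = B.image (· + x) := by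
  ext w
  simp only [mem_vadd_finset, vadd_eq_add, mem_image]
  constructor
  · rintro ⟨b, hb, rfl⟩; exact ⟨b, hb, add_comm b x⟩
  · rintro ⟨b, hb, rfl⟩; exact ⟨b, hb, add_comm x b⟩

/-- Translating `B` translates the representation function: `r_{A, x + B}(w) = r_{A,B}(w - x)`.
[cite: Nathanson1996, Thm 2.4 (proof)] -/
theorem rep_vadd_right (A B : Finset G) (x w : G) : rep A (x +ᵥ B) w = rep A B (w - x) := by
  have h := rep_image_add A B 0 x (w - x)
  rw [zero_add, sub_add_cancel] at h
  have hA : A.image (· + (0 : G)) = A := by simp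
  rw [hA, ← vadd_finset_eq_image] at h
  exact h

/-- `A + (x + B) = x + (A + B)` (translation bookkeeping of Nathanson's proof). [cite: Nathanson1996, Thm 2.4 (proof)] -/
theorem add_vadd_finset (A B : Finset G) (x : G) : A + (x +ᵥ B) = x +ᵥ (A + B) := by
  ext w
  simp only [mem_add, mem_vadd_finset, vadd_eq_add]
  constructor
  · rintro ⟨a, ha, _, ⟨b, hb, rfl⟩, rfl⟩
    exact ⟨a + b, ⟨a, ha, b, hb, rfl⟩, by abel⟩
  · rintro ⟨_, ⟨a, ha, b, hb, rfl⟩, rfl⟩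
    exact ⟨a, ha, x + b, ⟨b, hb, rfl⟩, by abel⟩

/-- Translation invariance `N_t(A, x + B) = N_t(A, B)`. [cite: Nathanson1996, Thm 2.4 (proof)] -/
theorem NS_vadd_right (t : ℕ) (A B : Finset G) (x : G) : NS t A (x +ᵥ B) = NS t A B := by
  unfold NS
  rw [add_vadd_finset]
  refine sum_nbij' (fun w => w - x) (fun w => w + x) ?_ ?_ ?_ ?_ ?_
  · intro w hw
    obtain ⟨v, hv, rfl⟩ := mem_vadd_finset.1 hw
    simpa using hv
  · intro w hw
    exact mem_vadd_finset.2 ⟨w, hw, by simp [add_comm]⟩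
  · intro w _; simp
  · intro w _; simp
  · intro w _; rw [rep_vadd_right]

end Grynkiewicz

end Literature.Combinatorics.Additive
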